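import Summits.ResolutionOfSingularities.KangarooAtlas.MizutaniCoefficientLift
import Summits.ResolutionOfSingularities.KangarooAtlas.MizutaniInvFormsTensor
import Summits.ResolutionOfSingularities.KangarooAtlas.MizutaniInvFormsLevel
import Summits.ResolutionOfSingularities.KangarooAtlas.MizutaniMultiplicity
import Summits.ResolutionOfSingularities.KangarooAtlas.MizutaniPowWitness
import Mathlib.RingTheory.Localization.AtPrime.Basic
import HarnessLib

/-!
# Mizutani's conjecture — ODA'S EQUALITY `U(𝔭) ∩ L_e = (L_B)_e` (Oda 1973 Prop. 2.2 (ii)) for every prime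

Cell topic `Summits/ResolutionOfSingularities/KangarooAtlas` (pub-rosobs); namespace
`Summit.ResolutionOfSingularities.KangarooAtlas.Mizutani`.  Companion to the Lean transcription of the in-house
note MIZUTANI-PROOF-g59 (AI-written, AI-audited; *AI review is weaker than expert review*; not a resolution
theorem).

`MizutaniMultiplicity.lean` transcribes Hironaka's/Mizutani's own invariant additive forms `U(𝔭) ∩ L_e`
(`hirForms`: `Σ a_j X_j^{p^e}` of multiplicity `≥ p^e` at `𝔭`, i.e. in the symbolic power `𝔭^{(p^e)}`) next to
Oda's printed description `(L_B)_e` by coefficient differential operators (`invForms`,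
`Literature/…/HironakaGroupScheme.lean`), and proves `U(𝔭) ∩ L_e ⊆ (L_B)_e`.  THIS FILE PROVES THE CONVERSE
**`invForms_le_hirForms`**, hence **`hirForms_eq_invForms`**, for EVERY prime ideal `𝔭 ⊂ k[X_0, …, X_n]` over
EVERY field `k` of characteristic `p` and every level `e` — Oda's theorem [O1, Prop. 2.2 (ii)] as quoted on
p. 1168 of Oda 1983-II ("by the Jacobian criterion"), here with a different, short proof:

Let `O = S_𝔭`, `𝔪 = 𝔭O`, `q = p^e`, `Ō = O/𝔪^q`, `κ = O/𝔪`, `K = k^q`, `h = Σ a_i X_i^q` with `a ∈ (L_B)_e`.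
1. (`MizutaniInvFormsTensor`) `a ∈ (L_B)_e ⟺ ρ_j(a) = Σ_i a_i ⊗ c_{ij} ∈ J^q ⊂ k ⊗_K k` for all `j`, where
   `ξ_i^q = Σ_j c_{ij} m_j` in a `k`-basis `(m_j)` of `span_k{ξ_i^q} ⊂ S/𝔭`; (`MizutaniPowWitness`) each
   `ρ_j(a)` comes from `J_F^q ⊂ F ⊗_K F` for the intermediate field `F = K(Y)`, `Y ⊂ k` a suitable finite set.
2. (`MizutaniPIndependent`, in the residue field `κ`) a finite `p`-independent `b ⊂ κ` with `κ^q(b)` containing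
   the images of `Y` and the `m_j`; (`MizutaniCoefficientLift`) the partial coefficient field
   `σ : κ^q(b) → Ō` and the ring map `Θ = ι ⊗ (σ∘φ̂) : F ⊗_K F → Ō`, which kills `J_F^q`.
3. Hence `Σ_i ι(a_i) σ(c_{ij}) = Θ(ρ_j) = 0` in `Ō` for every `j`; and since the `q`-th power map descends to
   `λ : κ → Ō` with `X̄_i^q = λ(ξ_i) = σ(ξ_i^q) = Σ_j σ(c_{ij}) σ(m_j)`, the image of `h` in `Ō` is
   `Σ_j σ(m_j) · Θ(ρ_j) = 0`, i.e. `h ∈ 𝔭^q S_𝔭 ∩ S = 𝔭^{(q)}`: `a ∈ U(𝔭) ∩ L_e`.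

Consequences recorded here: `hirForms_eq_invForms` (all primes, all levels); Mizutani's lower bound
`m(e) ≥ 2p^e − 1` READ THROUGH HIRONAKA'S OWN `U(𝔭) ∩ L` (`mizutaniLowerBound_hirForms'`, the hypothesis `hOda`
of `MizutaniMultiplicityBridge.mizutaniLowerBound_hirForms` discharged).  What this does NOT do: identify
Hironaka's scheme `B(𝔭) = Spec S/U_+(𝔭)S` with the subscheme cut out by the additive forms (Hironaka 1970 Thm. 1
Cor., the named fact `Hironaka1970_thm1_cor` of the res-hironaka cell) — the dimension side stays as in
`MizutaniHironakaDimension.lean`.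

References: [Oda1983HironakaGroupSchemeII] §2 (p. 1168: "[O_1, Proposition 2.2, (ii)] then showed that
(L_B(𝔭))_e = {h ∈ L_e ; Dh ∈ 𝔭 ∩ L_e for all D ∈ Diff_{p^e−1}(k/F^e(k))}"); [Mizutani1973HironakaGroupSchemes]
§1 (Def. 1.1, (c)), Lemma 2.4; [EGAIV4] §16.8.
-/

open MvPolynomial TensorProduct Literature.AlgebraicGeometry.Resolution
  Literature.AlgebraicGeometry.Resolution.HironakaScheme

namespace Summit.ResolutionOfSingularities.KangarooAtlas.Mizutani

universe u

section OdaEquality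

variable {k : Type u} [Field k] {p : ℕ} [hp : Fact p.Prime] [CharP k p] {n : ℕ}
  (𝔭 : Ideal (MvPolynomial (Fin (n + 1)) k)) [h𝔭 : 𝔭.IsPrime]

omit hp in
/-- `S_𝔭` has characteristic `p`. [folklore] -/
theorem charP_localizationAtPrime : CharP (Localization.AtPrime 𝔭) p :=
  charP_of_injective_algebraMap (algebraMap k (Localization.AtPrime 𝔭)).injective p

omit hp in
/-- The residue field `κ(𝔭)` has characteristic `p`. [folklore] -/
theorem charP_residueField : CharP (IsLocalRing.ResidueField (Localization.AtPrime 𝔭)) p :=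
  charP_of_injective_algebraMap (algebraMap k (IsLocalRing.ResidueField (Localization.AtPrime 𝔭))).injective p

/-- `S → S_𝔭` maps `𝔭` into the maximal ideal. [folklore] -/
theorem algebraMap_mem_maximalIdeal {f : MvPolynomial (Fin (n + 1)) k} (hf : f ∈ 𝔭) :
    algebraMap (MvPolynomial (Fin (n + 1)) k) (Localization.AtPrime 𝔭) f ∈
      IsLocalRing.maximalIdeal (Localization.AtPrime 𝔭) := by
  rw [← Localization.AtPrime.map_eq_maximalIdeal]
  exact Ideal.mem_map_of_mem _ hf

/-- `ψ : S/𝔭 → κ(𝔭)`, the residue field of `S_𝔭`. [folklore] -/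
noncomputable def quotToResidue :
    MvPolynomial (Fin (n + 1)) k ⧸ 𝔭 →+* IsLocalRing.ResidueField (Localization.AtPrime 𝔭) :=
  Ideal.Quotient.lift 𝔭
    ((IsLocalRing.residue (Localization.AtPrime 𝔭)).comp
      (algebraMap (MvPolynomial (Fin (n + 1)) k) (Localization.AtPrime 𝔭)))
    (fun f hf => by
      rw [RingHom.comp_apply, IsLocalRing.residue_eq_zero_iff]
      exact algebraMap_mem_maximalIdeal 𝔭 hf)

/-- `ψ (f mod 𝔭) = residue (f/1)`. [folklore] -/
@[simp] theorem quotToResidue_mk (f : MvPolynomial (Fin (n + 1)) k) :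
    quotToResidue 𝔭 (Ideal.Quotient.mk 𝔭 f) =
      IsLocalRing.residue (Localization.AtPrime 𝔭)
        (algebraMap (MvPolynomial (Fin (n + 1)) k) (Localization.AtPrime 𝔭) f) :=
  rfl

/-- `S → S_𝔭` on constants is `k → S_𝔭`. [folklore] -/
theorem algebraMap_C (c : k) :
    algebraMap (MvPolynomial (Fin (n + 1)) k) (Localization.AtPrime 𝔭) (C c) =
      algebraMap k (Localization.AtPrime 𝔭) c := by
  rw [← MvPolynomial.algebraMap_eq, ← IsScalarTower.algebraMap_apply]

/-- **Delocalisation**: if `f/1 ∈ 𝔪^m` in `S_𝔭` then `s f ∈ 𝔭^m` for some `s ∉ 𝔭` (`f ∈ 𝔭^{(m)}`). [folklore] -/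
theorem exists_mul_mem_pow_of_algebraMap_mem {f : MvPolynomial (Fin (n + 1)) k} {m : ℕ}
    (hf : algebraMap (MvPolynomial (Fin (n + 1)) k) (Localization.AtPrime 𝔭) f ∈
      IsLocalRing.maximalIdeal (Localization.AtPrime 𝔭) ^ m) :
    ∃ s ∉ 𝔭, s * f ∈ 𝔭 ^ m := by
  rw [← Localization.AtPrime.map_eq_maximalIdeal, ← Ideal.map_pow,
    IsLocalization.mem_map_algebraMap_iff 𝔭.primeCompl] at hf
  obtain ⟨⟨⟨i, hi⟩, ⟨t, ht⟩⟩, hit⟩ := hf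
  simp only at hit
  rw [← map_mul, IsLocalization.eq_iff_exists 𝔭.primeCompl] at hit
  obtain ⟨⟨c, hc⟩, hc'⟩ := hit
  simp only at hc'
  refine ⟨c * t, fun h => ?_, ?_⟩
  · exact (h𝔭.mem_or_mem h).elim hc ht
  · rw [show c * t * f = c * (f * t) by ring, hc']
    exact Ideal.mul_mem_left _ _ hi

omit hp [CharP k p] h𝔭 in
/-- Bookkeeping: if `x_i^N = Σ_j v_{ij} w_j` and `Σ_i u_i v_{ij} = 0` for all `j`, then `Σ_i u_i x_i^N = 0`. [folklore] -/
theorem sum_mul_pow_eq_zero {R : Type*} [CommRing R] {ι ι' : Type*} [Fintype ι] [Fintype ι']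
    (u x : ι → R) (v : ι → ι' → R) (w : ι' → R) (N : ℕ)
    (hx : ∀ i, x i ^ N = ∑ j, v i j * w j) (hv : ∀ j, ∑ i, u i * v i j = 0) :
    ∑ i, u i * x i ^ N = 0 := by
  simp_rw [hx, Finset.mul_sum]
  rw [Finset.sum_comm]
  refine Finset.sum_eq_zero fun j _ => ?_
  have h : ∑ i, u i * (v i j * w j) = (∑ i, u i * v i j) * w j := by
    rw [Finset.sum_mul]
    exact Finset.sum_congr rfl fun i _ => by ring
  rw [h, hv j, zero_mul]

set_option maxHeartbeats 400000 in
/-- **ODA'S EQUALITY, the inclusion `(L_B)_e ⊆ U(𝔭) ∩ L_e`** (Oda 1973 Prop. 2.2 (ii) "⊇"): for EVERY prime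
ideal `𝔭 ⊂ k[X_0, …, X_n]`, every field `k` of characteristic `p` and every `e`, an additive form
`h = Σ a_j X_j^{p^e}` such that `Σ D(a_j) X_j^{p^e} ∈ 𝔭` for all differential operators `D` of `k` over `k^{p^e}`
of order `< p^e` lies in the symbolic power `𝔭^{(p^e)}`: `s h ∈ 𝔭^{p^e}` for some `s ∉ 𝔭`.  Proof: partial
coefficient fields of `S_𝔭/𝔭^{p^e}S_𝔭` over finite `p`-independent envelopes in the residue field and the
kernel argument on `F ⊗_{k^q} F` (module docstring).
[cite: Oda1983HironakaGroupSchemeII, §2 (p. 1168: (L_B)_e = {h ∈ L_e ; Dh ∈ 𝔭 for all D ∈ Diff_{p^e−1}(k/F^e(k))}, after [O_1] Prop. 2.2 (ii))] -/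
theorem invForms_le_hirForms (e : ℕ) : invForms k p 𝔭 e ≤ hirForms k p 𝔭 e := by
  classical
  rcases Nat.eq_zero_or_pos e with rfl | he
  · rw [hirForms_zero]
  intro a ha
  haveI : CharP (Localization.AtPrime 𝔭) p := charP_localizationAtPrime 𝔭
  haveI : CharP (IsLocalRing.ResidueField (Localization.AtPrime 𝔭)) p := charP_residueField 𝔭
  -- Step 1: `ρ_j(a) ∈ J^q`, realised over a finitely generated intermediate field `F = k^q(Yk)`
  have hrho := (mem_invForms_iff_rho k p 𝔭 e a).mp ha
  have hY : ∀ j : Fin (cdim k p 𝔭 e), ∃ Y : Finset k, Realised (frobPow k p e) Y (p ^ e) (rho k p 𝔭 e j a) :=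
    fun j => exists_finset_realised_pow (p ^ e) (hrho j)
  choose Y hY using hY
  obtain ⟨Yk, hYk⟩ : ∃ Yk : Finset k, Yk = (Finset.univ.biUnion Y ∪ Finset.univ.image a) ∪
      Finset.univ.image (fun ij : Fin (n + 1) × Fin (cdim k p 𝔭 e) => coord k p 𝔭 e ij.1 ij.2) := ⟨_, rfl⟩
  obtain ⟨F, hFdef⟩ : ∃ F : IntermediateField (frobPow k p e) k,
      F = IntermediateField.adjoin (frobPow k p e) (Yk : Set k) := ⟨_, rfl⟩
  have hYkF : ∀ y ∈ Yk, y ∈ F := fun y hy => by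
    rw [hFdef]; exact IntermediateField.subset_adjoin _ _ (Finset.mem_coe.mpr hy)
  have haF : ∀ i, a i ∈ F := fun i => hYkF _ (by
    rw [hYk]
    exact Finset.mem_union_left _ (Finset.mem_union_right _ (Finset.mem_image_of_mem _ (Finset.mem_univ i))))
  have hcF : ∀ i j, coord k p 𝔭 e i j ∈ F := fun i j => hYkF _ (by
    rw [hYk]
    exact Finset.mem_union_right _ (Finset.mem_image.mpr ⟨(i, j), Finset.mem_univ _, rfl⟩))
  have hYF : ∀ j, (↑(Y j) : Set k) ⊆ (F : Set k) := fun j y hy => hYkF _ (by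
    rw [hYk]
    exact Finset.mem_union_left _ (Finset.mem_union_left _ (Finset.mem_biUnion.mpr ⟨j, Finset.mem_univ j, hy⟩)))
  -- Step 2: a finite `p`-independent envelope `κ^q(b)` in `κ` of the images of `Yk` and of the `m_j`
  set mκ : Fin (cdim k p 𝔭 e) → IsLocalRing.ResidueField (Localization.AtPrime 𝔭) := fun j =>
    quotToResidue 𝔭 ((cbasis k p 𝔭 e j : powSpan k p 𝔭 e) : MvPolynomial (Fin (n + 1)) k ⧸ 𝔭) with hmκ
  obtain ⟨Zκ, hZκ⟩ : ∃ Zκ : Finset (IsLocalRing.ResidueField (Localization.AtPrime 𝔭)),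
      Zκ = Yk.image (phiRes (Localization.AtPrime 𝔭)) ∪ Finset.univ.image mκ := ⟨_, rfl⟩
  obtain ⟨s, b, hb1, hZ⟩ :=
    exists_pIndep_adjoin (k := IsLocalRing.ResidueField (Localization.AtPrime 𝔭)) (p := p) e Zκ
  have hb : PIndep p e b := hb1.of_one e he
  have hZmem : ∀ z ∈ Zκ, z ∈ towerField e b := fun z hz => hZ (Finset.mem_coe.mpr hz)
  have hmκ_mem : ∀ j, mκ j ∈ towerField e b := fun j =>
    hZmem _ (by rw [hZκ]; exact Finset.mem_union_right _ (Finset.mem_image_of_mem _ (Finset.mem_univ j)))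
  have hF : ∀ x : F, phiRes (Localization.AtPrime 𝔭) (x : k) ∈ towerField e b := by
    rintro ⟨x, hx⟩
    change phiRes (Localization.AtPrime 𝔭) x ∈ towerField e b
    rw [hFdef] at hx
    induction hx using IntermediateField.adjoin_induction with
    | mem y hy =>
      exact hZmem _ (by rw [hZκ]; exact Finset.mem_union_left _ (Finset.mem_image_of_mem _ (Finset.mem_coe.mp hy)))
    | algebraMap z =>
      obtain ⟨c, hc⟩ := mem_frobPow_iff.mp z.2
      have hz : phiRes (Localization.AtPrime 𝔭) (z : k) ∈
          frobPow (IsLocalRing.ResidueField (Localization.AtPrime 𝔭)) p e :=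
        mem_frobPow_iff.mpr ⟨phiRes (Localization.AtPrime 𝔭) c, by rw [← map_pow, hc]⟩
      exact IntermediateField.algebraMap_mem (towerField e b) (⟨_, hz⟩ : frobPow _ p e)
    | add x y _ _ hx hy => rw [map_add]; exact add_mem hx hy
    | inv x _ hx => rw [map_inv₀]; exact inv_mem hx
    | mul x y _ _ hx hy => rw [map_mul]; exact mul_mem hx hy
  -- Step 3: `Θ(ρ_j) = 0`, i.e. `Σ_i ι(a_i) σ(φ̂ c_ij) = 0` in `Ō = S_𝔭/𝔪^q`
  have hvan : ∀ j : Fin (cdim k p 𝔭 e), ∑ i, iotaTrunc p e (Localization.AtPrime 𝔭) (a i) *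
      coeffLift (Localization.AtPrime 𝔭) p hb (phiHat F hF ⟨coord k p 𝔭 e i j, hcF i j⟩) = 0 := by
    intro j
    obtain ⟨ω₂, hω₂, heq⟩ := hY j F (hYF j)
    obtain ⟨ω, hω⟩ : ∃ ω : F ⊗[frobPow k p e] F,
        ω = ∑ i, (⟨a i, haF i⟩ : F) ⊗ₜ[frobPow k p e] (⟨coord k p 𝔭 e i j, hcF i j⟩ : F) := ⟨_, rfl⟩
    have hωeq : tensorIncl (frobPow k p e) F ω = rho k p 𝔭 e j a := by
      rw [hω, map_sum, rho_apply]
      exact Finset.sum_congr rfl fun i _ => by rw [Algebra.TensorProduct.map_tmul]; rfl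
    have hωω : ω = ω₂ := tensorIncl_injective (frobPow k p e) F (hωeq.trans heq.symm)
    have h0 := tensorKer_eq_zero_of_mem_pow hb F hF (hωω ▸ hω₂)
    rw [hω, tensorKer_sum_tmul] at h0
    exact h0
  -- Step 4: `X̄_i^q = Σ_j σ(φ̂ c_ij) σ(m̂_j)` in `Ō`
  set Xbar : Fin (n + 1) → Trunc (Localization.AtPrime 𝔭) p e := fun i =>
    truncMk (Localization.AtPrime 𝔭) p e
      (algebraMap (MvPolynomial (Fin (n + 1)) k) (Localization.AtPrime 𝔭) (X i)) with hXbar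
  have hXpow : ∀ i, Xbar i ^ p ^ e = ∑ j,
      coeffLift (Localization.AtPrime 𝔭) p hb (phiHat F hF ⟨coord k p 𝔭 e i j, hcF i j⟩) *
        coeffLift (Localization.AtPrime 𝔭) p hb ⟨mκ j, hmκ_mem j⟩ := by
    intro i
    -- `ξ_i^q = Σ_j c_ij m_j`, pushed to `κ`
    have hκeq : truncRes (Localization.AtPrime 𝔭) p e (Xbar i) ^ p ^ e =
        ∑ j, phiRes (Localization.AtPrime 𝔭) (coord k p 𝔭 e i j) * mκ j := by
      have h1 := congrArg (quotToResidue 𝔭) (xi_pow_eq_sum k p 𝔭 e i)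
      rw [map_pow, map_sum] at h1
      have hxi : quotToResidue 𝔭 (xi k 𝔭 i) = truncRes (Localization.AtPrime 𝔭) p e (Xbar i) := by
        rw [xi, quotToResidue_mk]; rfl
      rw [hxi] at h1
      rw [h1]
      refine Finset.sum_congr rfl fun j _ => ?_
      have hsm : coord k p 𝔭 e i j • ((cbasis k p 𝔭 e j : powSpan k p 𝔭 e) : MvPolynomial (Fin (n + 1)) k ⧸ 𝔭) =
          Ideal.Quotient.mk 𝔭 (C (coord k p 𝔭 e i j)) *
            ((cbasis k p 𝔭 e j : powSpan k p 𝔭 e) : MvPolynomial (Fin (n + 1)) k ⧸ 𝔭) :=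
        Algebra.smul_def (coord k p 𝔭 e i j)
          ((cbasis k p 𝔭 e j : powSpan k p 𝔭 e) : MvPolynomial (Fin (n + 1)) k ⧸ 𝔭)
      rw [hsm, map_mul, quotToResidue_mk, algebraMap_C]
      rfl
    have hmem : truncRes (Localization.AtPrime 𝔭) p e (Xbar i) ^ p ^ e ∈
        frobPow (IsLocalRing.ResidueField (Localization.AtPrime 𝔭)) p e := pow_mem_frobPow e _
    -- the same identity inside the field `κ^q(b)`
    have hEeq : algebraMap (frobPow (IsLocalRing.ResidueField (Localization.AtPrime 𝔭)) p e) (towerField e b)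
        ⟨truncRes (Localization.AtPrime 𝔭) p e (Xbar i) ^ p ^ e, hmem⟩ =
        ∑ j, phiHat F hF ⟨coord k p 𝔭 e i j, hcF i j⟩ * (⟨mκ j, hmκ_mem j⟩ : towerField e b) := by
      apply Subtype.ext
      rw [AddSubmonoidClass.coe_finsetSum]
      show truncRes (Localization.AtPrime 𝔭) p e (Xbar i) ^ p ^ e = _
      rw [hκeq]
      exact Finset.sum_congr rfl fun j _ => rfl
    rw [← algebraMap_frobPow_trunc_pow (Localization.AtPrime 𝔭) p e (Xbar i) hmem,
      ← (coeffLift (Localization.AtPrime 𝔭) p hb).commutes, hEeq, map_sum]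
    exact Finset.sum_congr rfl fun j _ => map_mul _ _ _
  -- Step 5: the image of `h` in `Ō = S_𝔭/𝔪^q` vanishes
  have hh : truncMk (Localization.AtPrime 𝔭) p e
      (algebraMap (MvPolynomial (Fin (n + 1)) k) (Localization.AtPrime 𝔭) (addForm k p e a)) = 0 := by
    have hexp : truncMk (Localization.AtPrime 𝔭) p e
        (algebraMap (MvPolynomial (Fin (n + 1)) k) (Localization.AtPrime 𝔭) (addForm k p e a)) =
        ∑ i, iotaTrunc p e (Localization.AtPrime 𝔭) (a i) * Xbar i ^ p ^ e := by
      unfold addForm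
      rw [map_sum (algebraMap (MvPolynomial (Fin (n + 1)) k) (Localization.AtPrime 𝔭)),
        map_sum (truncMk (Localization.AtPrime 𝔭) p e)]
      refine Finset.sum_congr rfl fun i _ => ?_
      rw [map_mul (algebraMap (MvPolynomial (Fin (n + 1)) k) (Localization.AtPrime 𝔭)),
        map_pow (algebraMap (MvPolynomial (Fin (n + 1)) k) (Localization.AtPrime 𝔭)), algebraMap_C,
        map_mul (truncMk (Localization.AtPrime 𝔭) p e), map_pow (truncMk (Localization.AtPrime 𝔭) p e)]
      rfl
    rw [hexp]
    exact sum_mul_pow_eq_zero _ _ _ _ _ hXpow hvan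
  -- Step 6: delocalise
  rw [Ideal.Quotient.eq_zero_iff_mem] at hh
  exact mem_hirForms_iff.mpr (exists_mul_mem_pow_of_algebraMap_mem 𝔭 hh)

/-- **ODA'S EQUALITY `U(𝔭) ∩ L_e = (L_B)_e`** (Oda 1973 Prop. 2.2 (ii), quoted in Oda 1983-II p. 1168) for every
prime ideal `𝔭 ⊂ k[X_0, …, X_n]`, every field `k` of characteristic `p`, every `e`: Hironaka's/Mizutani's
invariant additive forms (multiplicity `p^e` at `𝔭`, `hirForms`) ARE Oda's (coefficient differential operators,
`invForms`).  With this the definitions of `Literature/…/HironakaGroupScheme.lean` (`invForms`, `ExponentLE`,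
`hsDimAt`) agree with Mizutani 1973 §1 (c) (exponent of `B(𝔭)` := exponent of `U(𝔭) ∩ L`) in the tree.
[cite: Oda1983HironakaGroupSchemeII, §2 (p. 1168); Mizutani1973HironakaGroupSchemes, §1 (Def. 1.1, (c))] -/
theorem hirForms_eq_invForms (e : ℕ) : hirForms k p 𝔭 e = invForms k p 𝔭 e :=
  le_antisymm (hirForms_le_invForms 𝔭 e) (invForms_le_hirForms 𝔭 e)

/-- Oda's `exponent ≤ e₀` is Mizutani's: `(U ∩ L)_j = k·F^{j−e₀}(U ∩ L)_{e₀}` for all `j ≥ e₀` iff `ExponentLE`.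
[cite: Mizutani1973HironakaGroupSchemes, §1 (c); Oda1983HironakaGroupSchemeII, §2 (p. 1168)] -/
theorem exponentLE_iff_hirForms (e₀ : ℕ) :
    ExponentLE k p 𝔭 e₀ ↔ ∀ j, e₀ ≤ j → hirForms k p 𝔭 j =
      Submodule.span k (frobVec k p (j - e₀) '' (hirForms k p 𝔭 e₀ : Set (Fin (n + 1) → k))) := by
  unfold ExponentLE
  simp only [hirForms_eq_invForms]

end OdaEquality

end Summit.ResolutionOfSingularities.KangarooAtlas.Mizutani

/-! ## Appendix (encloser-1 g4): the symbolic power is literally `𝔭^d S_𝔭 ∩ S` -/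

namespace Summit.ResolutionOfSingularities.KangarooAtlas.Mizutani

section SymbolicPower

universe w

variable {k : Type w} [Field k] {n : ℕ} (𝔭 : Ideal (MvPolynomial (Fin (n + 1)) k)) [h𝔭 : 𝔭.IsPrime]

/-- **`𝔭^{(d)} = 𝔭^d S_𝔭 ∩ S`, literally**: `∃ s ∉ 𝔭, s·f ∈ 𝔭^d` (the tree's transcription of «`mult_𝔭 f ≥ d`»,
`symbPow` / `hirForms`) iff the image of `f` in the local ring `S_𝔭` lies in the `d`-th power of the maximal ideal —
the order-`≥ d` condition in `𝒪_{𝔸^{n+1},𝔭}` that Hironaka's and Mizutani's multiplicity refers to (for a form of degree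
`d` on the smooth `ℙ^n`: multiplicity `≥ d` at the point `𝔭`).  Recorded for the reviewer of the definitional residue
(G3) of the cell's MIZUTANI-LEAN.md. [cite: Mizutani1973HironakaGroupSchemes, §1 Def. 1.1 (U_m(p) = {f ∈ S_m : mult_p(Proj(S/fS)) ≥ m})] -/
theorem exists_mul_mem_pow_iff_algebraMap_mem (f : MvPolynomial (Fin (n + 1)) k) (d : ℕ) :
    (∃ s ∉ 𝔭, s * f ∈ 𝔭 ^ d) ↔
      algebraMap (MvPolynomial (Fin (n + 1)) k) (Localization.AtPrime 𝔭) f ∈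
        IsLocalRing.maximalIdeal (Localization.AtPrime 𝔭) ^ d := by
  refine ⟨?_, exists_mul_mem_pow_of_algebraMap_mem 𝔭⟩
  rintro ⟨s, hs, hsf⟩
  have hmem : algebraMap (MvPolynomial (Fin (n + 1)) k) (Localization.AtPrime 𝔭) (s * f) ∈
      IsLocalRing.maximalIdeal (Localization.AtPrime 𝔭) ^ d := by
    rw [← Localization.AtPrime.map_eq_maximalIdeal, ← Ideal.map_pow]
    exact Ideal.mem_map_of_mem _ hsf
  rw [map_mul] at hmem
  have hunit : IsUnit (algebraMap (MvPolynomial (Fin (n + 1)) k) (Localization.AtPrime 𝔭) s) :=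
    IsLocalization.map_units (Localization.AtPrime 𝔭) (⟨s, hs⟩ : 𝔭.primeCompl)
  exact (Ideal.unit_mul_mem_iff_mem _ hunit).mp hmem

/-- Hence `a ∈ hirForms k p 𝔭 e` iff the additive form `Σ a_j X_j^{p^e}` has order `≥ p^e` in `S_𝔭`. [cite: Mizutani1973HironakaGroupSchemes, §1 Def. 1.1 and (c)] -/
theorem mem_hirForms_iff_algebraMap_mem (p : ℕ) [Fact p.Prime] [CharP k p] (e : ℕ) (a : Fin (n + 1) → k) :
    a ∈ hirForms k p 𝔭 e ↔
      algebraMap (MvPolynomial (Fin (n + 1)) k) (Localization.AtPrime 𝔭) (addForm k p e a) ∈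
        IsLocalRing.maximalIdeal (Localization.AtPrime 𝔭) ^ p ^ e :=
  (mem_hirForms_iff).trans (exists_mul_mem_pow_iff_algebraMap_mem 𝔭 _ _)

end SymbolicPower

end Summit.ResolutionOfSingularities.KangarooAtlas.Mizutani
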